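import Summits.RiemannHypothesis.RiemannHypothesis.Theorems.RuelleBandAsymptoticToRealisation
import Summits.RiemannHypothesis.RiemannHypothesis.Theorems.RuelleBandBandEngineCore

/-!
# Route `RuelleBand`, line `interior-edge-split`: the EDGE stub as a spectral-radius GAP

Periphery of line `interior-edge-split` of crux `AsymptoticCriticalLine`
(stmt-RiemannHypothesis-2063, lead c1). The crux splits losslessly as
`NoRightInteriorBand ∧ EdgeZeroFreeStrip`; the INTERIOR stub is an essential-spectrum statement
(the windowed / three-circle engines), while the EDGE stub
`EdgeZeroFreeStrip : ∃ δ > 0, ζ has no zero with 1 − δ < Re s < 1` (= route `Strip`'s crux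
stmt-RiemannHypothesis-10660, open) is typed here as a spectral-radius GAP statement:

  `EdgeZeroFreeStrip ↔ ∃ (H, T : ℝ → H →L[ℂ] H, t₀ > 0, δ₀ > 0),`
  `  spectralRadius (T t₀) ≤ e^{(1/2 − δ₀) t₀} ∧ every zero with 1/2 < Re s < 1 is a joint`
  `  eigenvalue of T with character t ↦ e^{t(s − 1/2)}`

(`edgeZeroFreeStrip_iff_gapRealisation`). No group law and no continuity of `T` are required.

* `⟸`: a realised zero `s` gives the eigenvalue `e^{t₀(s − 1/2)} ∈ σ(T t₀)`
  (`RuelleBand.exp_mem_spectrum_of_jointEigenvector`), whose modulus `e^{t₀(Re s − 1/2)}` is at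
  most the spectral radius `≤ e^{(1/2 − δ₀)t₀}`, so `Re s ≤ 1 − δ₀`; take `δ := min δ₀ (1/2)`.
* `⟹` (honesty, the diagonal model): on `ℓ²` over the zeros with `1/2 < Re s < 1` put
  `T t := diag(e^{t(s − 1/2)})` (`HilbertBasis.diagonalCLM`); the basis vectors are joint
  eigenvectors, and since every such zero has `Re s ≤ 1 − δ`, `‖T 1‖ ≤ ‖symbol‖_∞ ≤ e^{1/2 − δ}`,
  whence `spectralRadius (T 1) ≤ e^{1/2 − δ}` (`σ(a) ⊆ closedBall 0 (‖a‖‖1‖)`, `‖id‖ ≤ 1`).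

As an `∃`-statement the typing is therefore circular (the diagonal model realises it as soon as
the edge stub holds): this is a CALIBRATION of the edge half of the line, not progress on `ζ`.
Compare the gap typing AT THE LINE (`r(T t₀) ≤ 1` for all strip zeros ⟹ RH in the strip, no
converse); here the gap is AT THE EDGE and the converse is honest.
-/

noncomputable section

namespace Summit.RiemannHypothesis.RiemannHypothesis.Theorems

open Complex
open scoped lp ENNReal

namespace EdgeGap

/-- If the spectral radius of `a` is at most `r ≥ 0` (as an `ℝ≥0∞` bound `ENNReal.ofReal r`),
every spectral value has modulus at most `r` (unfolding `spectralRadius = ⨆ k ∈ σ a, ‖k‖₊`).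
[folklore] -/
theorem norm_le_of_spectralRadius_le_ofReal {A : Type*} [Ring A] [Algebra ℂ A] {a : A} {r : ℝ}
    (hr : 0 ≤ r) (h : spectralRadius ℂ a ≤ ENNReal.ofReal r) {k : ℂ} (hk : k ∈ spectrum ℂ a) :
    ‖k‖ ≤ r := by
  have h1 : ENNReal.ofReal ‖k‖ ≤ ENNReal.ofReal r := by
    rw [ofReal_norm, enorm_eq_nnnorm]
    exact le_trans (le_iSup₂ (α := ℝ≥0∞) k hk) h
  exact (ENNReal.ofReal_le_ofReal_iff hr).1 h1

/-- A norm bound on a bounded operator bounds its spectral radius: `‖T‖ ≤ r` implies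
`spectralRadius ℂ T ≤ r` (`σ(T) ⊆ closedBall 0 (‖T‖ · ‖1‖)` and `‖1‖ = ‖id‖ ≤ 1`; no
`NormOneClass` needed, so the zero space is allowed). [folklore] -/
theorem spectralRadius_le_ofReal_of_norm_le {H : Type*} [NormedAddCommGroup H] [NormedSpace ℂ H]
    [CompleteSpace H] {T : H →L[ℂ] H} {r : ℝ} (h : ‖T‖ ≤ r) :
    spectralRadius ℂ T ≤ ENNReal.ofReal r := by
  refine iSup₂_le fun k hk => ?_
  have h1 : ‖k‖ ≤ r :=
    calc ‖k‖ ≤ ‖T‖ * ‖(1 : H →L[ℂ] H)‖ := spectrum.norm_le_norm_mul_of_mem hk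
      _ ≤ r * 1 := mul_le_mul h ContinuousLinearMap.norm_id_le (norm_nonneg _)
          ((norm_nonneg _).trans h)
      _ = r := mul_one r
  calc (‖k‖₊ : ℝ≥0∞) = ENNReal.ofReal ‖k‖ := (ofReal_norm k).symm
    _ ≤ ENNReal.ofReal r := ENNReal.ofReal_le_ofReal h1

/-- **The diagonal gap family.** For any family `ρ : ι → ℂ` with `0 < Re (ρ i) ≤ 1 − δ`
(`δ > 0`), the diagonal operators `T t := diag(e^{t(ρ i − 1/2)})` on `ℓ²(ι, ℂ)` have every `ρ i`
as a joint eigenvalue (eigenvector the `i`-th basis vector) and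
`spectralRadius (T 1) ≤ e^{(1/2 − δ) · 1}` (`‖diag(m)‖ ≤ ‖m‖_∞ ≤ e^{1/2 − δ}`). [folklore] -/
theorem exists_diagonalGapFamily {ι : Type} (ρ : ι → ℂ) {δ : ℝ} (hδ : 0 < δ)
    (hρ : ∀ i, 0 < (ρ i).re ∧ (ρ i).re ≤ 1 - δ) :
    ∃ T : ℝ → ℓ²(ι, ℂ) →L[ℂ] ℓ²(ι, ℂ),
      spectralRadius ℂ (T 1) ≤ ENNReal.ofReal (Real.exp ((1 / 2 - δ) * 1)) ∧
      ∀ i : ι, ∃ v : ℓ²(ι, ℂ), v ≠ 0 ∧ ∀ t : ℝ, T t v = cexp (↑t * (ρ i - 1 / 2)) • v := by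
  set b : HilbertBasis ι ℂ ℓ²(ι, ℂ) := default
  have hre : ∀ i, (ρ i - 1 / 2).re = (ρ i).re - 1 / 2 := fun i => by simp
  -- the symbols `e^{t(ρ − 1/2)}` are bounded by `e^{|t|}`
  have hmem : ∀ t : ℝ, Memℓp (fun i => cexp (↑t * (ρ i - 1 / 2))) ⊤ := by
    intro t
    refine memℓp_infty ⟨Real.exp |t|, ?_⟩
    rintro _ ⟨i, rfl⟩
    dsimp only
    rw [Complex.norm_exp, Real.exp_le_exp, Complex.re_ofReal_mul]
    have h1 : |(ρ i - 1 / 2).re| ≤ 1 := by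
      have := hρ i
      rw [hre, abs_le]
      constructor <;> linarith
    calc t * (ρ i - 1 / 2).re ≤ |t * (ρ i - 1 / 2).re| := le_abs_self _
      _ = |t| * |(ρ i - 1 / 2).re| := abs_mul _ _
      _ ≤ |t| * 1 := mul_le_mul_of_nonneg_left h1 (abs_nonneg _)
      _ = |t| := mul_one _
  set m : ℝ → lp (fun _ : ι => ℂ) ⊤ := fun t => ⟨_, hmem t⟩
  have hm : ∀ t i, m t i = cexp (↑t * (ρ i - 1 / 2)) := fun t i => rfl
  refine ⟨fun t => b.diagonalCLM (m t), ?_, fun i => ?_⟩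
  · -- the gap: `‖m 1‖_∞ ≤ e^{1/2 − δ}`
    have hm1 : ‖m 1‖ ≤ Real.exp ((1 / 2 - δ) * 1) := by
      refine lp.norm_le_of_forall_le (Real.exp_pos _).le fun i => ?_
      rw [hm, Complex.norm_exp, Real.exp_le_exp, Complex.re_ofReal_mul, hre]
      have := hρ i
      linarith
    exact spectralRadius_le_ofReal_of_norm_le ((b.norm_diagonalCLM_le (m 1)).trans hm1)
  · refine ⟨b i, b.orthonormal.ne_zero i, fun t => ?_⟩
    change b.diagonalCLM (m t) (b i) = _
    rw [b.diagonalCLM_basis, hm]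

end EdgeGap

/-- **The edge stub as a spectral-radius gap** (periphery of line `interior-edge-split`, crux
stmt-RiemannHypothesis-2063). `EdgeZeroFreeStrip` (`∃ δ > 0`, no zero of `ζ` with
`1 − δ < Re s < 1`; = route `Strip`'s crux stmt-RiemannHypothesis-10660) holds iff some
`ℝ`-indexed family of bounded operators on a complex Hilbert space realises every zero with
`1/2 < Re s < 1` as a joint eigenvector with character `t ↦ e^{t(s − 1/2)}` AND has a
spectral-radius gap `spectralRadius (T t₀) ≤ e^{(1/2 − δ₀)t₀}` at some time `t₀ > 0`, `δ₀ > 0`.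
`⟸`: eigenvalue `e^{t₀(s − 1/2)} ∈ σ(T t₀)` has modulus `≤` the spectral radius, so `Re s ≤ 1 − δ₀`.
`⟹`: the diagonal model `EdgeGap.exists_diagonalGapFamily` on `ℓ²` over the zeros with
`1/2 < Re s < 1` (all of which have `Re s ≤ 1 − δ`). A calibration: the typing is circular, not
progress on `ζ`.
[folklore] -/
theorem edgeZeroFreeStrip_iff_gapRealisation :
    (∃ δ : ℝ, 0 < δ ∧ ∀ s : ℂ, riemannZeta s = 0 → 1 - δ < s.re → s.re < 1 → False) ↔
      ∃ (H : Type) (_ : NormedAddCommGroup H) (_ : InnerProductSpace ℂ H) (_ : CompleteSpace H)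
        (T : ℝ → H →L[ℂ] H) (t₀ δ₀ : ℝ), 0 < t₀ ∧ 0 < δ₀ ∧
        spectralRadius ℂ (T t₀) ≤ ENNReal.ofReal (Real.exp ((1 / 2 - δ₀) * t₀)) ∧
        (∀ s : ℂ, riemannZeta s = 0 → 1 / 2 < s.re → s.re < 1 →
          ∃ v : H, v ≠ 0 ∧ ∀ t : ℝ, T t v = Complex.exp (↑t * (s - 1 / 2)) • v) := by
  constructor
  · -- honesty: the diagonal model over the zeros with `1/2 < Re s < 1`
    rintro ⟨δ, hδ, hδ'⟩
    have hρ : ∀ i : {s : ℂ // riemannZeta s = 0 ∧ 1 / 2 < s.re ∧ s.re < 1},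
        0 < (i : ℂ).re ∧ (i : ℂ).re ≤ 1 - δ := fun i =>
      ⟨by have := i.2.2.1; linarith, not_lt.1 fun h => hδ' i.1 i.2.1 h i.2.2.2⟩
    obtain ⟨T, hgap, heig⟩ :=
      EdgeGap.exists_diagonalGapFamily (ι := {s : ℂ // riemannZeta s = 0 ∧ 1 / 2 < s.re ∧ s.re < 1})
        (fun i => (i : ℂ)) hδ hρ
    exact ⟨ℓ²({s : ℂ // riemannZeta s = 0 ∧ 1 / 2 < s.re ∧ s.re < 1}, ℂ), inferInstance,
      inferInstance, inferInstance, T, 1, δ, one_pos, hδ, hgap,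
      fun s hs h1 h2 => heig ⟨s, hs, h1, h2⟩⟩
  · rintro ⟨H, _, _, _, T, t₀, δ₀, ht₀, hδ₀, hgap, heig⟩
    refine ⟨min δ₀ (1 / 2), lt_min hδ₀ one_half_pos, fun s hs h1 h2 => ?_⟩
    have hmin1 := min_le_left δ₀ (1 / 2)
    have hmin2 := min_le_right δ₀ (1 / 2)
    obtain ⟨v, hv0, hv⟩ := heig s hs (by linarith) h2
    have hμ := RuelleBand.exp_mem_spectrum_of_jointEigenvector T t₀ hv0 (hv t₀)
    have hle := EdgeGap.norm_le_of_spectralRadius_le_ofReal (Real.exp_pos _).le hgap hμ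
    rw [Complex.norm_exp, Complex.re_ofReal_mul, Real.exp_le_exp] at hle
    have hre : (s - 1 / 2).re = s.re - 1 / 2 := by simp
    rw [hre] at hle
    have hs' : s.re ≤ 1 - δ₀ := by nlinarith
    linarith

end Summit.RiemannHypothesis.RiemannHypothesis.Theorems

end
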